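import Literature.Probability.Percolation.QuadCrossingSpace

/-!
# Crossing values on transposing-symmetric quads under (E2) + (D)

Route `Summits/CriticalPhenomena/CardyFormulaZ2/Theses/CardyMeckeFlip`, crux `MeckeRigidity`
(item stmt-CriticalPhenomena-14826), line `registered`, stub `stub_crossingUniqueness` (helper).

The only two hypotheses of the crux that speak about the law `P` alone — isometry invariance (E2)
and exact self-duality on crossing cylinders (D) — already determine the crossing value of every
quad `Q` that some plane isometry `g` carries onto a transpose of itself (same carrier, sides
shifted by one: squares, discs with four quarter arcs, every conformal SQUARE realised
symmetrically): `P(⊞_Q) = 1/2`.  More generally the **sum rule** `P(⊞_Q) + P(⊞_{g·Qᵗ}) = 1` holds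
for every transpose `Qᵗ` of `Q` and every isometry `g` (a rectangle crossed the long way and the
congruent rectangle crossed the short way have complementary probabilities).  Consequently the
uniqueness statement `stub_crossingUniqueness` holds on such quads for ANY two laws satisfying
(E2) + (D), with common value `1/2 = F(1/2)` (Cardy's value at cross-ratio `1/2`); this is the
classical "the square is crossed with probability `1/2`" argument, and the only part of the
uniqueness stub that does not need the flip structure.

Contents: `measure_crossedEvent_isometry` ((E2) transports `⊞_Q`), `measure_crossedEvent_add_eq_one`
(sum rule in `ℝ≥0∞`), `measureReal_crossedEvent_add_eq_one`, `measureReal_crossedEvent_eq_half`,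
`measureReal_crossedEvent_eq_of_transposing_isometry` (uniqueness on symmetric quads) and its registered
`∀`-form `crossingUniqueness_of_transposing_isometry`.
-/

noncomputable section

open MeasureTheory Set
open Literature.Probability.Percolation Literature.Probability.Percolation.QuadCrossing

namespace Summit.CriticalPhenomena.CardyFormulaZ2.Theorems.CardyMeckeFlip

/-- The isometric image of a quad is its image under the underlying plane homeomorphism
(definitional). [folklore] -/
theorem quad_isometry_eq_mapHomeomorph (g : ℂ ≃ᵢ ℂ) (Q : Quad (univ : Set ℂ)) :
    Q.isometry g = Q.mapHomeomorph g.toHomeomorph := rfl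

/-- The motion of configurations by `g` pulls the crossing event of `g · Q` back to the crossing
event of `Q`. [folklore] -/
theorem preimage_isometry_crossedEvent (g : ℂ ≃ᵢ ℂ) (Q : Quad (univ : Set ℂ)) :
    QuadConfig.isometry g ⁻¹' QuadConfig.crossedEvent (Q.isometry g) =
      QuadConfig.crossedEvent Q := by
  ext S
  simp only [mem_preimage, QuadConfig.mem_crossedEvent, QuadConfig.isometry,
    quad_isometry_eq_mapHomeomorph, QuadConfig.mem_mapHomeomorph,
    Quad.mapHomeomorph_symm_mapHomeomorph]

/-- **(E2) transports crossing events**: an isometry-invariant probability law gives `⊞_{g·Q}` and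
`⊞_Q` the same mass.  (The invariance hypothesis forces `S ↦ g · S` to be `P`-a.e. measurable:
otherwise the push-forward would be `0`.) [folklore] -/
theorem measure_crossedEvent_isometry (P : Measure (QuadConfig (univ : Set ℂ)))
    [IsProbabilityMeasure P]
    (hE2 : ∀ g : ℂ ≃ᵢ ℂ, Measure.map (QuadConfig.isometry g) P = P) (g : ℂ ≃ᵢ ℂ)
    (Q : Quad (univ : Set ℂ)) :
    P (QuadConfig.crossedEvent (Q.isometry g)) = P (QuadConfig.crossedEvent Q) := by
  have hae : AEMeasurable (QuadConfig.isometry g) P := by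
    by_contra h
    have h0 : Measure.map (QuadConfig.isometry g) P = 0 := Measure.map_of_not_aemeasurable h
    rw [hE2 g] at h0
    exact (IsProbabilityMeasure.ne_zero P) h0
  conv_lhs => rw [← hE2 g]
  rw [Measure.map_apply_of_aemeasurable hae (QuadConfig.measurableSet_crossedEvent _),
    preimage_isometry_crossedEvent]

/-- **Sum rule from (D) + (E2)**, in `ℝ≥0∞`: for a transpose `Qᵗ` of `Q` (same carrier, sides
shifted by one) and any plane isometry `g`, `P(⊞_Q) + P(⊞_{g·Qᵗ}) = 1`. [folklore] -/
theorem measure_crossedEvent_add_eq_one (P : Measure (QuadConfig (univ : Set ℂ)))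
    [IsProbabilityMeasure P]
    (hE2 : ∀ g : ℂ ≃ᵢ ℂ, Measure.map (QuadConfig.isometry g) P = P)
    (hD : ∀ (n : ℕ) (Q Qt : Fin n → Quad (univ : Set ℂ)),
      (∀ i, (Qt i).carrier = (Q i).carrier ∧ (Qt i).side 0 = (Q i).side 1 ∧
        (Qt i).side 1 = (Q i).side 2 ∧ (Qt i).side 2 = (Q i).side 3 ∧ (Qt i).side 3 = (Q i).side 0) →
      ∀ A : Set (Set (Fin n)), P {S | {i | Q i ∈ S} ∈ A} = P {S | {i | Qt i ∉ S} ∈ A})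
    (Q Qt : Quad (univ : Set ℂ))
    (ht : Qt.carrier = Q.carrier ∧ Qt.side 0 = Q.side 1 ∧ Qt.side 1 = Q.side 2 ∧
      Qt.side 2 = Q.side 3 ∧ Qt.side 3 = Q.side 0)
    (g : ℂ ≃ᵢ ℂ) :
    P (QuadConfig.crossedEvent Q) + P (QuadConfig.crossedEvent (Qt.isometry g)) = 1 := by
  -- (D) on the one-quad family, tested on the pattern "index 0 is crossed"
  have key := hD 1 (fun _ => Q) (fun _ => Qt) (fun _ => ht) {T | (0 : Fin 1) ∈ T}
  have hL : {S : QuadConfig (univ : Set ℂ) | {i : Fin 1 | Q ∈ S} ∈ {T : Set (Fin 1) | (0 : Fin 1) ∈ T}}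
      = QuadConfig.crossedEvent Q := by
    ext S; simp
  have hR : {S : QuadConfig (univ : Set ℂ) | {i : Fin 1 | Qt ∉ S} ∈ {T : Set (Fin 1) | (0 : Fin 1) ∈ T}}
      = (QuadConfig.crossedEvent Qt)ᶜ := by
    ext S; simp
  rw [hL, hR, prob_compl_eq_one_sub (QuadConfig.measurableSet_crossedEvent Qt)] at key
  rw [measure_crossedEvent_isometry P hE2 g Qt, key]
  exact tsub_add_cancel_of_le prob_le_one

/-- **Sum rule, real form**: `P.real ⊞_Q + P.real ⊞_{g·Qᵗ} = 1`. [folklore] -/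
theorem measureReal_crossedEvent_add_eq_one (P : Measure (QuadConfig (univ : Set ℂ)))
    [IsProbabilityMeasure P]
    (hE2 : ∀ g : ℂ ≃ᵢ ℂ, Measure.map (QuadConfig.isometry g) P = P)
    (hD : ∀ (n : ℕ) (Q Qt : Fin n → Quad (univ : Set ℂ)),
      (∀ i, (Qt i).carrier = (Q i).carrier ∧ (Qt i).side 0 = (Q i).side 1 ∧
        (Qt i).side 1 = (Q i).side 2 ∧ (Qt i).side 2 = (Q i).side 3 ∧ (Qt i).side 3 = (Q i).side 0) →
      ∀ A : Set (Set (Fin n)), P {S | {i | Q i ∈ S} ∈ A} = P {S | {i | Qt i ∉ S} ∈ A})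
    (Q Qt : Quad (univ : Set ℂ))
    (ht : Qt.carrier = Q.carrier ∧ Qt.side 0 = Q.side 1 ∧ Qt.side 1 = Q.side 2 ∧
      Qt.side 2 = Q.side 3 ∧ Qt.side 3 = Q.side 0)
    (g : ℂ ≃ᵢ ℂ) :
    P.real (QuadConfig.crossedEvent Q) + P.real (QuadConfig.crossedEvent (Qt.isometry g)) = 1 := by
  have h := measure_crossedEvent_add_eq_one P hE2 hD Q Qt ht g
  have h' := congrArg ENNReal.toReal h
  rwa [ENNReal.toReal_add (measure_ne_top P _) (measure_ne_top P _), ENNReal.toReal_one] at h'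

/-- **The square argument**: if some isometry `g` carries `Q` onto a transpose of itself
(`[g·Q] = [Q]`, `∂ₖ(g·Q) = ∂ₖ₊₁Q`), then `P(⊞_Q) = 1/2` for every law with (E2) + (D).
[folklore] -/
theorem measureReal_crossedEvent_eq_half (P : Measure (QuadConfig (univ : Set ℂ)))
    [IsProbabilityMeasure P]
    (hE2 : ∀ g : ℂ ≃ᵢ ℂ, Measure.map (QuadConfig.isometry g) P = P)
    (hD : ∀ (n : ℕ) (Q Qt : Fin n → Quad (univ : Set ℂ)),
      (∀ i, (Qt i).carrier = (Q i).carrier ∧ (Qt i).side 0 = (Q i).side 1 ∧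
        (Qt i).side 1 = (Q i).side 2 ∧ (Qt i).side 2 = (Q i).side 3 ∧ (Qt i).side 3 = (Q i).side 0) →
      ∀ A : Set (Set (Fin n)), P {S | {i | Q i ∈ S} ∈ A} = P {S | {i | Qt i ∉ S} ∈ A})
    (Q : Quad (univ : Set ℂ)) (g : ℂ ≃ᵢ ℂ)
    (ht : (Q.isometry g).carrier = Q.carrier ∧ (Q.isometry g).side 0 = Q.side 1 ∧
      (Q.isometry g).side 1 = Q.side 2 ∧ (Q.isometry g).side 2 = Q.side 3 ∧
      (Q.isometry g).side 3 = Q.side 0) :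
    P.real (QuadConfig.crossedEvent Q) = 1 / 2 := by
  have h := measureReal_crossedEvent_add_eq_one P hE2 hD Q (Q.isometry g) ht g.symm
  have hback : (Q.isometry g).isometry g.symm = Q := by
    simp only [quad_isometry_eq_mapHomeomorph]
    exact Quad.mapHomeomorph_symm_mapHomeomorph g.toHomeomorph Q
  rw [hback] at h
  linarith

/-- **Uniqueness of crossing values on transposing-symmetric quads** (the symmetric case of
`stub_crossingUniqueness`, with only (E2) + (D) used): any two isometry-invariant exactly self-dual
probability laws on `ℋ_ℂ` give the same probability — namely `1/2` — to every quad carried onto a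
transpose of itself by a plane isometry. [folklore] -/
theorem measureReal_crossedEvent_eq_of_transposing_isometry
    (P P' : Measure (QuadConfig (univ : Set ℂ))) [IsProbabilityMeasure P] [IsProbabilityMeasure P']
    (hE2 : ∀ g : ℂ ≃ᵢ ℂ, Measure.map (QuadConfig.isometry g) P = P)
    (hE2' : ∀ g : ℂ ≃ᵢ ℂ, Measure.map (QuadConfig.isometry g) P' = P')
    (hD : ∀ (n : ℕ) (Q Qt : Fin n → Quad (univ : Set ℂ)),
      (∀ i, (Qt i).carrier = (Q i).carrier ∧ (Qt i).side 0 = (Q i).side 1 ∧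
        (Qt i).side 1 = (Q i).side 2 ∧ (Qt i).side 2 = (Q i).side 3 ∧ (Qt i).side 3 = (Q i).side 0) →
      ∀ A : Set (Set (Fin n)), P {S | {i | Q i ∈ S} ∈ A} = P {S | {i | Qt i ∉ S} ∈ A})
    (hD' : ∀ (n : ℕ) (Q Qt : Fin n → Quad (univ : Set ℂ)),
      (∀ i, (Qt i).carrier = (Q i).carrier ∧ (Qt i).side 0 = (Q i).side 1 ∧
        (Qt i).side 1 = (Q i).side 2 ∧ (Qt i).side 2 = (Q i).side 3 ∧ (Qt i).side 3 = (Q i).side 0) →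
      ∀ A : Set (Set (Fin n)), P' {S | {i | Q i ∈ S} ∈ A} = P' {S | {i | Qt i ∉ S} ∈ A})
    (Q : Quad (univ : Set ℂ)) (g : ℂ ≃ᵢ ℂ)
    (ht : (Q.isometry g).carrier = Q.carrier ∧ (Q.isometry g).side 0 = Q.side 1 ∧
      (Q.isometry g).side 1 = Q.side 2 ∧ (Q.isometry g).side 2 = Q.side 3 ∧
      (Q.isometry g).side 3 = Q.side 0) :
    P.real (QuadConfig.crossedEvent Q) = P'.real (QuadConfig.crossedEvent Q) := by
  rw [measureReal_crossedEvent_eq_half P hE2 hD Q g ht, measureReal_crossedEvent_eq_half P' hE2' hD' Q g ht]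


/-- **Uniqueness of crossing values on transposing-symmetric quads, registered form** (sub-goal
`crossingUniqueness_of_transposing_isometry` of item stmt-CriticalPhenomena-14826: the case of
`stub_crossingUniqueness` that (E2) + (D) settle alone; the kernel clauses are not needed and not
assumed): two isometry-invariant exactly self-dual probability laws on `ℋ_ℂ` agree on every quad that a
plane isometry carries onto a transpose of itself. [folklore] -/
theorem crossingUniqueness_of_transposing_isometry : ∀ (P P' : Measure (QuadConfig (Set.univ : Set ℂ))), IsProbabilityMeasure P → IsProbabilityMeasure P' → (∀ g : ℂ ≃ᵢ ℂ, Measure.map (QuadConfig.isometry g) P = P) → (∀ g : ℂ ≃ᵢ ℂ, Measure.map (QuadConfig.isometry g) P' = P') → (∀ (n : ℕ) (Q Qt : Fin n → Quad (Set.univ : Set ℂ)), (∀ i, (Qt i).carrier = (Q i).carrier ∧ (Qt i).side 0 = (Q i).side 1 ∧ (Qt i).side 1 = (Q i).side 2 ∧ (Qt i).side 2 = (Q i).side 3 ∧ (Qt i).side 3 = (Q i).side 0) → ∀ A : Set (Set (Fin n)), P {S | {i | Q i ∈ S} ∈ A} = P {S | {i | Qt i ∉ S} ∈ A}) → (∀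 (n : ℕ) (Q Qt : Fin n → Quad (Set.univ : Set ℂ)), (∀ i, (Qt i).carrier = (Q i).carrier ∧ (Qt i).side 0 = (Q i).side 1 ∧ (Qt i).side 1 = (Q i).side 2 ∧ (Qt i).side 2 = (Q i).side 3 ∧ (Qt i).side 3 = (Q i).side 0) → ∀ A : Set (Set (Fin n)), P' {S | {i | Q i ∈ S} ∈ A} = P' {S | {i | Qt i ∉ S} ∈ A}) → ∀ (Q : Quad (Set.univ : Set ℂ)) (g : ℂ ≃ᵢ ℂ), (Q.isometry g).carrier = Q.carrier → (Q.isometry g).side 0 = Q.side 1 → (Q.isometry g).side 1 = Q.side 2 → (Q.isometry g).side 2 = Q.side 3 → (Q.isometry g).side 3 = Q.side 0 → P.real (QuadConfig.crossedEvent Q) = P'.real (QuadConfig.crossedEvent Q) := by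
  intro P P' hP hP' hE2 hE2' hD hD' Q g hc h0 h1 h2 h3
  exact measureReal_crossedEvent_eq_of_transposing_isometry P P' hE2 hE2' hD hD' Q g ⟨hc, h0, h1, h2, h3⟩

end Summit.CriticalPhenomena.CardyFormulaZ2.Theorems.CardyMeckeFlip

end
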